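import Summits.ValiantsHypothesis.Statement
import Summits.ValiantsHypothesis.ValiantsHypothesis.Theorems.HubHub
import Literature.Computability.AlgebraicComplexity.DeterminantalComplexity

/-!
# ValiantsHypothesis / GCTMult, DetQP — item `Assembly` (stmt-ValiantsHypothesis-0316), closed

The shared assembly item `Assembly` of the routes `GCTMult` (where it is the second hypothesis of the
deciding theorem `closes : GctThesis → Assembly → ValiantsHypothesis`) and `DetQP` (legacy there):
given, as hypotheses, (i) every `VP` family has quasi-polynomially bounded determinantal complexity
(`VP ⊆ VQP` = quasi-polynomial projections of `DET`; Bürgisser–Clausen–Shokrollahi 1997,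
Cor. (21.40) with Thm. (21.27), (21.33); Valiant–Skyum–Berkowitz–Rackoff 1983), (ii) `dc(per_n)`
is NOT quasi-polynomially bounded, (iii) the `ofFintype` renaming bridge
`perFamily ℂ ∈ VP ℂ ↔ IsVPFamily (fun n => perPoly (Fin n) ℂ)` (Bürgisser 2000, Rem. 2.2) and
(iv) Valiant's theorem `per ∈ VNP` (Valiant 1979; Bürgisser 2000, Thm. 2.10), conclude
`ValiantsHypothesis` (`VP_ℂ ≠ VNP_ℂ`). Pure bookkeeping: if `VP ℂ = VNP ℂ` then `per ∈ VP`, so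
`(per_n)` is a `VP` family by (iii), so `dc(per_n)` is quasi-polynomially bounded by (i),
contradicting (ii); packaged through the hub lemma
`Summit.ValiantsHypothesis.Hub.valiantsHypothesis_of_not_isVPFamily_per` (`Theorems/HubHub.lean`).
The signature is stated VERBATIM (the item's body), so this file imports neither route file; all
four hypotheses are discharged elsewhere in the tree
(`isQPBounded_determinantalComplexity_of_isVPFamily_holds`, `mem_VP_ofFintype_iff_holds`,
`perFamily_mem_VNP_holds`; (ii) is the crux `DetqpThesis` / the conclusion of
`Summit.PneNP.GCT.not_isQPBounded_dc_of_multObstructionsBeyondQuasiPoly`), which is why the closed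
form `Summit.PneNP.GCT.valiantsHypothesis_of_not_isQPBounded_dc` (`SufficesForValiant.lean`) needs
only (ii). HONEST FRAMING: bookkeeping; nothing here is progress on `VP ≠ VNP` — hypothesis (ii) is
open.
-/

-- layout Summits/ValiantsHypothesis/ValiantsHypothesis forces the duplicated namespace component
set_option linter.dupNamespace false

namespace Summit.ValiantsHypothesis.ValiantsHypothesis.Theorems.GCTMult

open Literature.Computability.AlgebraicComplexity

/-- **Item `Assembly` (stmt-ValiantsHypothesis-0316; `Theses.GCTMult.Assembly` = `Theses.DetQP.Assembly`,
signature verbatim):** (VP families have qp-bounded `dc`) → (`dc(per_n)` not qp-bounded) →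
(renaming bridge for the permanent family) → (`per ∈ VNP`) → `ValiantsHypothesis`.
Proof: if `(per_n)` were a `VP` family its `dc` would be qp-bounded by the first hypothesis,
contradicting the second; the hub lemma `Hub.valiantsHypothesis_of_not_isVPFamily_per` turns
`per ∉ VP` (unbundled), the bridge and `per ∈ VNP` into `VP ℂ ≠ VNP ℂ`.
[cite: BurgisserClausenShokrollahi1997, Cor. (21.40)] -/
theorem assembly_proof :
    (∀ {σ : ℕ → Type} [∀ n, Fintype (σ n)] (f : ∀ n, MvPolynomial (σ n) ℂ),
        Literature.Computability.AlgebraicComplexity.IsVPFamily f →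
          Literature.Computability.AlgebraicComplexity.IsQPBounded (fun n =>
            Literature.Computability.AlgebraicComplexity.determinantalComplexity (f n))) →
      ¬ Literature.Computability.AlgebraicComplexity.IsQPBounded (fun n =>
          Literature.Computability.AlgebraicComplexity.determinantalComplexity
            (Literature.Computability.AlgebraicComplexity.perPoly (Fin n) ℂ)) →
      (Literature.Computability.AlgebraicComplexity.perFamily ℂ ∈
            Literature.Computability.AlgebraicComplexity.VP ℂ ↔
          Literature.Computability.AlgebraicComplexity.IsVPFamily (fun n =>
            Literature.Computability.AlgebraicComplexity.perPoly (Fin n) ℂ)) →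
      Literature.Computability.AlgebraicComplexity.perFamily_mem_VNP ℂ → ValiantsHypothesis := by
  intro hVPqp hnqp hbridge hVNP
  refine Summit.ValiantsHypothesis.Hub.valiantsHypothesis_of_not_isVPFamily_per ?_ hbridge hVNP
  intro hVP
  exact hnqp (hVPqp (fun n => perPoly (Fin n) ℂ) hVP)

end Summit.ValiantsHypothesis.ValiantsHypothesis.Theorems.GCTMult
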